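import Summits.BirchSwinnertonDyer.Rank1Residual.Additive.TwistPartnerForcedReduction
import Summits.BirchSwinnertonDyer.Rank1Residual.Additive.TameBranchUnique
import Literature.NumberTheory.EllipticCurves.PAdicLFunctionNonsplitRiemannSumCertificateProofs
import HarnessLib

/-!
# RIEMANN-SUM CERTIFICATE FOR THE E-NORMALISED TAME BRANCH OF THE FORCED TWIST PARTNER: the
# truncation bound for EVERY witness, and the unit coefficient from ONE finite sum of `f`'s own
# `χ`-twisted modular symbols (cell `b2b-bsdres`, sub-cell additive-p2 = X3♯(G-ord) / X4♯(G-ord),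
# gen 24; sequel of `TwistPartnerForcedReduction.lean`; curve-level JOIN in
# `TwistPartnerForcedCertificateJoin.lean`)

HONEST FRAMING (cell `b2b-bsdres`, run/shared/lean/b2b/bsd-rank1-residual/, verbatim in every
file): the goal of the cell is to DELETE the COMBINATION-SHAPED residual classes of the
Birch–Swinnerton-Dyer formula for ALL analytic-rank `≤ 1` elliptic curves over `ℚ` — "full BSD
formula for every rank `≤ 1` curve in class `C`" assembled STRICTLY from published theorems — so
that the rank-`≤ 1` remainder becomes exactly the CONSTRUCTION-SHAPED classes, which are TYPED
(missing-input `Prop`s), NOT attempted. This is not "finishing BSD". Sub-cell additive-p2: the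
classes X3♯(G-ord) / X4♯(G-ord) are CONSTRUCTION-SHAPED and stay so; labels / RESIDUAL-MAP marks
UNCHANGED; nothing is booked. THEOREMS ONLY (no definition, no named fact, no conjecture node);
every unproved input — the typed Kato half `TameBranchRatDvdAt` (or the named facts Delbourgo 2002
(A), (A_M), (C) that discharge it), `PlusSymbolsPIntegralAt`, the boundedness of the forced partner,
the finite Riemann-sum inequality — is an explicit hypothesis (referee-1 rule R1). An instrument's
Riemann sum (`HOME/b2b-bsdres-additive-p2/gen23/ENGINE-FORCED-PARTNER.md` §4, 13 Gord_e346 rows;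
gen 24 `gen24/`) is EVIDENCE for the last hypothesis, never a proof of it.

## What

Gen 23 reduced the ONE typed modular-forms input of the tame-branch route on defect `e ∈ {3,4,6}`
(cc-typer-2's `CensusX43.HasOrdinaryTwistPartner χ f_E`, in print the symbol of Delbourgo's
`p`-ordinary newform `f̃ = f_E ⊗ ε̄`) to boundedness of the explicit FORCED partner
`Φ = TwistPartner.forced χ [·]⁺_{f_E} ã` (`hasOrdinaryTwistPartner_iff_of_addv`), which then
PRODUCES the E-normalised tame branch `IsTameBranchOf f_E p (ι∘χ) ã B`
(`exists_isTameBranchOf_of_bounded_forced`) as the Mellin transform of the explicit measure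
`μ(a + p^{n+1}ℤ_p) = ã^{−(n+1)}χ̄(a)Φ(a/p^{n+1})` (`twistPartnerMeasure_forced_succ`). The consumers
of that branch (`charLamLeAt_of_tameBranchRatDvdAt_of_integral_of_norm_coeff_eq_one`, gen 20's §5–§6
rank-one theorems) need ONE more per-pair bit: a UNIT coefficient `‖[T^k]B‖ = 1` (`k ≤ rank`). This
file turns that bit into a FINITE statement about `E`'s own symbols:

* §1 (any partner data `(Φ, ã)`, Riemann sums `RS k n = ∑_η ∑_{s mod pⁿ} μ(ηγˢ + p^{n+1}ℤ_p)·(s choose k)`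
  entered through the hypothesis `hRS` exactly as in `PAdicMeasureTransform`): the bridge WITH the
  truncation bound — `exists_isTameBranchOf_riemannSum_of_twistPartnerData`: `∃ B` of the package
  with `‖[T^k]B − RS k n‖ ≤ (C/‖k!‖)·p⁻ⁿ` for EVERY bound `C` of the plus symbols (the tree's
  `exists_powerSeries_of_bounded_distribution_riemannSum` + the squeeze `max ‖Φ‖ ≤ max ‖[·]⁺_f‖`);
  by `IsTameBranchOf.unique` the bound holds for EVERY `B` of the package
  (`IsTameBranchOf.norm_coeff_sub_riemannSum_le_of_twistPartnerData`), whence the isosceles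
  CERTIFICATE `(C/‖k!‖)·p⁻ⁿ < ‖RS k n‖ ⟹ ‖[T^k]B‖ = ‖RS k n‖ ∧ [T^k]B ≠ 0`.
* §2 (the FORCED partner; `U_p[·]⁺_f = 0`, `χ ≠ 1`, `‖ã‖ = 1`, `Φ` bounded): the same three
  statements for `Φ = forced χ [·]⁺_f ã`, and the UNIT form: integral plus symbols, `k < p`,
  `n ≥ 1`, `‖RS k n‖ = 1 ⟹ ‖[T^k]B‖ = 1` for every `B` with `IsTameBranchOf f p (ι∘χ) ã B`.
* the curve-level JOIN on the X4-3 locus (defect `3, 4, 6`: typed Kato half +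
  `PlusSymbolsPIntegralAt` + `∃` bound of the forced partner + `‖RS k n‖ = 1` ⟹ `CharLamLeAt W p k`,
  Schneider at `r_an = 1`, the valuation identity) is the sequel file
  `TwistPartnerForcedCertificateJoin.lean`.

What is NOT claimed: boundedness of the forced partner (Manin–Drinfeld for `f̃`; the typed input),
`PlusSymbolsPIntegralAt` off the surjective rows, any `μ`-statement, any lower half, any booking.

References: B. Mazur, J. Tate, J. Teitelbaum, Invent. Math. 84 (1986) §I.10 (10.1), §I.11–I.14
(14.3) [MazurTateTeitelbaum1986Invent]; W. Stein, C. Wuthrich, Math. Comp. 82 (2013) §3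
[SteinWuthrich2013]; D. Delbourgo, J. Number Theory 95 (2002) Thm. (A)–(C) p. 40 [Delbourgo2002];
D. Delbourgo, Compositio Math. 113 (1998) §1.5 [Delbourgo1998]; L. Washington, GTM 83 §7.1
[Washington1997]; HOME/b2b-bsdres-additive-p2/gen23/ENGINE-FORCED-PARTNER.md (EVIDENCE).
-/

noncomputable section

open scoped Classical MatrixGroups ModularForm NumberField

open CongruenceSubgroup Literature.NumberTheory.EllipticCurves
  Literature.NumberTheory.EllipticCurves.ModularForms
  Literature.NumberTheory.EllipticCurves.Rank1Residual

namespace Summit.BirchSwinnertonDyer.Rank1Residual.Additive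

/-! ### §1 Partner data `(Φ, ã)`: the bridge WITH the truncation bound, for EVERY witness -/

section Data

variable {p : ℕ} [hp : Fact p.Prime] {N : ℕ} {f : CuspForm (Gamma0 N) 2}
  {χ : MulChar (ZMod p) ℚ_[p]} {Φ : ℚ → ℚ_[p]} {ã : ℚ_[p]} {RS : ℕ → ℕ → ℚ_[p]}
  (hRS : ∀ k n : ℕ, RS k n =
      ∑ᶠ ξ : rootsOfUnity (Literature.NumberTheory.EllipticCurves.torsionOrder p) ℤ_[p],
        ∑ s : ZMod (p ^ n),
        twistPartnerMeasure χ Φ ã ((ratPlusSymbol f 0 : ℚ) : ℚ_[p]) (n + cyclotomicExponent p)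
            (PadicInt.toZModPow (n + cyclotomicExponent p) ((ξ : ℤ_[p]ˣ) : ℤ_[p]) *
              (cyclotomicGenerator p : ZMod (p ^ (n + cyclotomicExponent p))) ^ s.val) *
          ((s.val.choose k : ℕ) : ℚ_[p]))

include hRS

/-- **The bridge WITH the truncation bound.** For named partner data `(Φ, ã)` of the newform symbol
`[·]⁺_f` and `χ ≠ 1` — `‖ã‖ = 1`, `Φ` `1`-periodic, `[·]⁺_f = τ_{χ⁻¹}Φ`, `∑_d Φ(s + d/p) = ãΦ(ps)`,
sup attained at `s₁` — the Mellin transform `B` of `μ = χ̄·μ_Φ` (`twistPartnerMeasure`) satisfies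
`IsTameBranchOf f p (ι∘χ) ã B`, the integrality transfer `(∀ r, ‖[r]⁺_f‖ ≤ C) → ∀ n, ‖[Tⁿ]B‖ ≤ C`,
AND the truncation bound `‖[T^k]B − RS k n‖ ≤ (C/‖k!‖_p)·p⁻ⁿ` against its Riemann sums
`RS k n = ∑_η ∑_{s mod pⁿ} μ(ηγˢ + p^{n+1}ℤ_p)·(s choose k)` for every plus-symbol bound `C`
(cc-typer-2's `exists_isTameBranchOf_of_twistPartnerData`, same proof, run on the tree's
`exists_powerSeries_of_bounded_distribution_riemannSum`; the constant is moved from `max ‖Φ‖` to `C`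
by the squeeze `norm_le_of_twist_partner`).
[cite: MazurTateTeitelbaum1986Invent, §I.13–I.14 (14.3)] [cite: SteinWuthrich2013, §3] -/
theorem exists_isTameBranchOf_riemannSum_of_twistPartnerData (hχ : χ ≠ 1) (hã : ‖ã‖ = 1)
    (hper : ∀ s, Φ (s + 1) = Φ s)
    (hx : ∀ s, ((ratPlusSymbol f s : ℚ) : ℚ_[p]) = CensusX43.twist χ⁻¹ Φ s)
    (hU : ∀ s, ∑ d : ZMod p, Φ (s + (d.val : ℚ) / p) = ã * Φ (p * s))
    {s₁ : ℚ} (hs₁ : ∀ s, ‖Φ s‖ ≤ ‖Φ s₁‖) :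
    ∃ B : PowerSeries ℚ_[p], IsTameBranchOf f p (χ.ringHomComp (algebraMap ℚ_[p] ℂ_[p])) ã B ∧
      (∀ C : ℝ, (∀ r : ℚ, ‖((ratPlusSymbol f r : ℚ) : ℚ_[p])‖ ≤ C) →
        ∀ n : ℕ, ‖PowerSeries.coeff n B‖ ≤ C) ∧
      ∀ C : ℝ, (∀ r : ℚ, ‖((ratPlusSymbol f r : ℚ) : ℚ_[p])‖ ≤ C) →
        ∀ k n : ℕ, ‖PowerSeries.coeff k B - RS k n‖ ≤
          C / ‖((k.factorial : ℕ) : ℚ_[p])‖ * (p : ℝ) ^ (-n : ℤ) := by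
  have hã0 : ã ≠ 0 := fun h0 ↦ by rw [h0, norm_zero] at hã; exact zero_ne_one hã
  have hx' : ∀ s, ((ratPlusSymbol f s : ℚ) : ℚ_[p]) = ∑ c : ZMod p, χ⁻¹ c * Φ (s + (c.val : ℚ) / p) :=
    hx
  have hdist := twistPartnerMeasure_distribution χ hã0 hx' hU
  have hC := norm_twistPartnerMeasure_le χ hã hx' hs₁
  obtain ⟨L, hbd, h0, hint, hRSle⟩ := exists_powerSeries_of_bounded_distribution_riemannSum hRS hdist hC
  refine ⟨L, ⟨⟨‖Φ s₁‖, hbd⟩, ?_, ?_⟩, ?_, ?_⟩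
  · -- the constant term `μ(ℤ_p^×) = ã⁻¹ [0]⁺_f`
    rw [h0]
    haveI : NeZero (p ^ 1) := ⟨pow_ne_zero _ hp.out.ne_zero⟩
    have h1 := sum_units_mul_of_distribution hdist (RingHom.id ℚ_[p]) (m := 1)
      (L := cyclotomicExponent p) le_rfl (Nat.pos_of_ne_zero (cyclotomicExponent_ne_zero p))
      (fun _ ↦ (1 : ℚ_[p]))
    simp only [RingHom.id_apply, mul_one] at h1
    rw [h1, sum_units_eq_sum_filter_isUnit (F := fun a : ZMod (p ^ 1) ↦
      twistPartnerMeasure χ Φ ã ((ratPlusSymbol f 0 : ℚ) : ℚ_[p]) 1 a)]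
    have hfil : Finset.univ.filter (fun a : ZMod (p ^ 1) ↦ IsUnit a) = Finset.univ.erase 0 := by
      ext a
      simp [isUnit_iff_ne_zero_level_one]
    rw [hfil, Finset.sum_erase_eq_sub (Finset.mem_univ _)]
    have hz : twistPartnerMeasure χ Φ ã ((ratPlusSymbol f 0 : ℚ) : ℚ_[p]) 1 0 = 0 := by
      rw [twistPartnerMeasure_succ, ZMod.val_zero, Nat.cast_zero, MulChar.map_zero, mul_zero,
        zero_mul]
    rw [hz, sub_zero]
    simp_rw [twistPartnerMeasure_succ, zero_add, pow_one ã⁻¹, mul_assoc]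
    rw [← Finset.mul_sum, sum_level_one_eq χ Φ, ← hx' 0]
  · -- the interpolation rows, `m ≥ 2`
    intro m hm κ hκ heven hord
    obtain ⟨m', rfl⟩ : ∃ m', m = m' + 1 := ⟨m - 1, by omega⟩
    have h' := hint m' κ heven hord
    rwa [sum_mul_twistPartnerMeasure_eq hm hχ hper hx' hκ] at h'
  · -- integrality transfer: `max ‖Φ‖ ≤ C`
    intro C hCx n
    exact (hbd n).trans (norm_le_of_twist_partner χ hχ hã hper hx' hU hs₁ hCx)
  · -- truncation bound, with the constant moved from `‖Φ s₁‖` to `C`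
    intro C hCx k n
    have hΦC : ‖Φ s₁‖ ≤ C := norm_le_of_twist_partner χ hχ hã hper hx' hU hs₁ hCx
    refine (hRSle k n).trans ?_
    have hp0 : (0 : ℝ) ≤ (p : ℝ) ^ (-n : ℤ) := zpow_nonneg (Nat.cast_nonneg p) _
    have hk0 : (0 : ℝ) ≤ ‖((k.factorial : ℕ) : ℚ_[p])‖ := norm_nonneg _
    exact mul_le_mul_of_nonneg_right (div_le_div_of_nonneg_right hΦC hk0) hp0

/-- **Truncation bound for EVERY witness.** Under the same partner data, EVERY `B` with
`IsTameBranchOf f p (ι∘χ) ã B` IS the transform of `χ̄·μ_Φ` (`IsTameBranchOf.unique`), hence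
`‖[T^k]B − RS k n‖ ≤ (C/‖k!‖_p)·p⁻ⁿ` for every plus-symbol bound `C`.
[cite: MazurTateTeitelbaum1986Invent, §I.11–I.14] [cite: SteinWuthrich2013, §3] -/
theorem IsTameBranchOf.norm_coeff_sub_riemannSum_le_of_twistPartnerData (hχ : χ ≠ 1)
    (hã : ‖ã‖ = 1) (hper : ∀ s, Φ (s + 1) = Φ s)
    (hx : ∀ s, ((ratPlusSymbol f s : ℚ) : ℚ_[p]) = CensusX43.twist χ⁻¹ Φ s)
    (hU : ∀ s, ∑ d : ZMod p, Φ (s + (d.val : ℚ) / p) = ã * Φ (p * s))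
    {s₁ : ℚ} (hs₁ : ∀ s, ‖Φ s‖ ≤ ‖Φ s₁‖) {B : PowerSeries ℚ_[p]}
    (hB : IsTameBranchOf f p (χ.ringHomComp (algebraMap ℚ_[p] ℂ_[p])) ã B)
    {C : ℝ} (hCx : ∀ r : ℚ, ‖((ratPlusSymbol f r : ℚ) : ℚ_[p])‖ ≤ C) (k n : ℕ) :
    ‖PowerSeries.coeff k B - RS k n‖ ≤ C / ‖((k.factorial : ℕ) : ℚ_[p])‖ * (p : ℝ) ^ (-n : ℤ) := by
  obtain ⟨B₀, hB₀, -, hRSle⟩ :=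
    exists_isTameBranchOf_riemannSum_of_twistPartnerData hRS hχ hã hper hx hU hs₁
  rw [hB.unique hB₀]
  exact hRSle C hCx k n

/-- **CERTIFICATE (isosceles) for EVERY witness**: if ONE Riemann sum beats the truncation bound,
`(C/‖k!‖_p)·p⁻ⁿ < ‖RS k n‖`, then `‖[T^k]B‖ = ‖RS k n‖` and `[T^k]B ≠ 0` for every `B` of the
package `IsTameBranchOf f p (ι∘χ) ã`. [cite: SteinWuthrich2013, §3] [cite: MazurTateTeitelbaum1986Invent, §I.11–I.14] -/
theorem IsTameBranchOf.norm_coeff_eq_riemannSum_of_twistPartnerData_of_lt (hχ : χ ≠ 1)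
    (hã : ‖ã‖ = 1) (hper : ∀ s, Φ (s + 1) = Φ s)
    (hx : ∀ s, ((ratPlusSymbol f s : ℚ) : ℚ_[p]) = CensusX43.twist χ⁻¹ Φ s)
    (hU : ∀ s, ∑ d : ZMod p, Φ (s + (d.val : ℚ) / p) = ã * Φ (p * s))
    {s₁ : ℚ} (hs₁ : ∀ s, ‖Φ s‖ ≤ ‖Φ s₁‖) {B : PowerSeries ℚ_[p]}
    (hB : IsTameBranchOf f p (χ.ringHomComp (algebraMap ℚ_[p] ℂ_[p])) ã B)
    {C : ℝ} (hCx : ∀ r : ℚ, ‖((ratPlusSymbol f r : ℚ) : ℚ_[p])‖ ≤ C) {k n : ℕ}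
    (hlt : C / ‖((k.factorial : ℕ) : ℚ_[p])‖ * (p : ℝ) ^ (-n : ℤ) < ‖RS k n‖) :
    ‖PowerSeries.coeff k B‖ = ‖RS k n‖ ∧ PowerSeries.coeff k B ≠ 0 := by
  have herr : ‖PowerSeries.coeff k B - RS k n‖ < ‖RS k n‖ :=
    (hB.norm_coeff_sub_riemannSum_le_of_twistPartnerData hRS hχ hã hper hx hU hs₁ hCx k n).trans_lt
      hlt
  have heq : ‖PowerSeries.coeff k B‖ = ‖RS k n‖ := by
    have h := IsUltrametricDist.norm_add_eq_max_of_norm_ne_norm herr.ne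
    rw [sub_add_cancel, max_eq_right herr.le] at h
    exact h
  refine ⟨heq, fun h0 ↦ ?_⟩
  have hC0 : 0 ≤ C := (norm_nonneg _).trans (hCx 0)
  have hpos : 0 < ‖RS k n‖ :=
    lt_of_le_of_lt (mul_nonneg (div_nonneg hC0 (norm_nonneg _)) (zpow_nonneg (by positivity) _))
      hlt
  rw [h0, norm_zero] at heq
  exact hpos.ne heq

end Data

/-! ### §2 The FORCED partner: truncation bound and the unit certificate from one finite sum -/

section Forced

variable {p : ℕ} [hp : Fact p.Prime] {N : ℕ} [NeZero N] {f : CuspForm (Gamma0 N) 2}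
  {χ : MulChar (ZMod p) ℚ_[p]} {ã : ℚ_[p]} {RS : ℕ → ℕ → ℚ_[p]}
  (hRS : ∀ k n : ℕ, RS k n =
      ∑ᶠ ξ : rootsOfUnity (Literature.NumberTheory.EllipticCurves.torsionOrder p) ℤ_[p],
        ∑ s : ZMod (p ^ n),
        twistPartnerMeasure χ
            (TwistPartner.forced χ (fun r ↦ ((ratPlusSymbol f r : ℚ) : ℚ_[p])) ã) ã
            ((ratPlusSymbol f 0 : ℚ) : ℚ_[p]) (n + cyclotomicExponent p)
            (PadicInt.toZModPow (n + cyclotomicExponent p) ((ξ : ℤ_[p]ˣ) : ℤ_[p]) *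
              (cyclotomicGenerator p : ZMod (p ^ (n + cyclotomicExponent p))) ^ s.val) *
          ((s.val.choose k : ℕ) : ℚ_[p]))

include hRS

/-- **The forced tame branch WITH the truncation bound.** For `χ ≠ 1`, a unit `ã`, `U_p[·]⁺_f = 0`
(`∑_d [s + d/p]⁺_f = 0`; automatic at an additive prime) and the forced partner
`Φ = forced χ [·]⁺_f ã` BOUNDED: there is `B` with `IsTameBranchOf f p (ι∘χ) ã B`, the integrality
transfer, and `‖[T^k]B − RS k n‖ ≤ (C/‖k!‖_p)·p⁻ⁿ` against the Riemann sums of the explicit measure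
`μ(a + p^{n+1}ℤ_p) = ã^{−(n+1)}χ̄(a)Φ(a/p^{n+1})` (`twistPartnerMeasure_forced_succ`: a finite sum of
`χ`-twisted plus symbols of `f`). [cite: MazurTateTeitelbaum1986Invent, §I.10 (10.1) and §I.14 (14.3)]
[cite: SteinWuthrich2013, §3] -/
theorem exists_isTameBranchOf_riemannSum_of_bounded_forced (hχ : χ ≠ 1) (hã : ‖ã‖ = 1)
    (hU0 : ∀ s, ∑ d : ZMod p, ratPlusSymbol f (s + (d.val : ℚ) / p) = 0) {C₀ : ℝ}
    (hC₀ : ∀ s, ‖TwistPartner.forced χ (fun r ↦ ((ratPlusSymbol f r : ℚ) : ℚ_[p])) ã s‖ ≤ C₀) :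
    ∃ B : PowerSeries ℚ_[p], IsTameBranchOf f p (χ.ringHomComp (algebraMap ℚ_[p] ℂ_[p])) ã B ∧
      (∀ C : ℝ, (∀ r : ℚ, ‖((ratPlusSymbol f r : ℚ) : ℚ_[p])‖ ≤ C) →
        ∀ n : ℕ, ‖PowerSeries.coeff n B‖ ≤ C) ∧
      ∀ C : ℝ, (∀ r : ℚ, ‖((ratPlusSymbol f r : ℚ) : ℚ_[p])‖ ≤ C) →
        ∀ k n : ℕ, ‖PowerSeries.coeff k B - RS k n‖ ≤
          C / ‖((k.factorial : ℕ) : ℚ_[p])‖ * (p : ℝ) ^ (-n : ℤ) := by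
  set x : ℚ → ℚ_[p] := fun r ↦ ((ratPlusSymbol f r : ℚ) : ℚ_[p]) with hxdef
  have hperx : ∀ s, x (s + 1) = x s := fun s ↦ by
    simp only [hxdef]
    rw [show (s + 1 : ℚ) = s + ((1 : ℤ) : ℚ) by push_cast; rfl, ratPlusSymbol_add_intCast_eq]
  have hU0' : ∀ s, ∑ d : ZMod p, x (s + (d.val : ℚ) / p) = 0 := fun s ↦ by
    simp only [hxdef]
    exact_mod_cast congrArg (fun q : ℚ ↦ (q : ℚ_[p])) (hU0 s)
  obtain ⟨hper', hx', hU'⟩ := TwistPartner.forced_isPartner hχ hã hperx hU0'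
  obtain ⟨s₁, hs₁⟩ := TwistPartner.exists_forall_norm_le_norm_of_bounded hC₀
  exact exists_isTameBranchOf_riemannSum_of_twistPartnerData hRS hχ hã hper' (fun s ↦ hx' s) hU' hs₁

/-- **Truncation bound for EVERY witness of the forced tame branch**: under the same hypotheses,
every `B` with `IsTameBranchOf f p (ι∘χ) ã B` satisfies `‖[T^k]B − RS k n‖ ≤ (C/‖k!‖_p)·p⁻ⁿ` for
every plus-symbol bound `C` (`IsTameBranchOf.unique`). [cite: SteinWuthrich2013, §3]
[cite: MazurTateTeitelbaum1986Invent, §I.11–I.14] -/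
theorem IsTameBranchOf.norm_coeff_sub_forcedRiemannSum_le (hχ : χ ≠ 1) (hã : ‖ã‖ = 1)
    (hU0 : ∀ s, ∑ d : ZMod p, ratPlusSymbol f (s + (d.val : ℚ) / p) = 0) {C₀ : ℝ}
    (hC₀ : ∀ s, ‖TwistPartner.forced χ (fun r ↦ ((ratPlusSymbol f r : ℚ) : ℚ_[p])) ã s‖ ≤ C₀)
    {B : PowerSeries ℚ_[p]} (hB : IsTameBranchOf f p (χ.ringHomComp (algebraMap ℚ_[p] ℂ_[p])) ã B)
    {C : ℝ} (hCx : ∀ r : ℚ, ‖((ratPlusSymbol f r : ℚ) : ℚ_[p])‖ ≤ C) (k n : ℕ) :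
    ‖PowerSeries.coeff k B - RS k n‖ ≤ C / ‖((k.factorial : ℕ) : ℚ_[p])‖ * (p : ℝ) ^ (-n : ℤ) := by
  obtain ⟨B₀, hB₀, -, hRSle⟩ := exists_isTameBranchOf_riemannSum_of_bounded_forced hRS hχ hã hU0 hC₀
  rw [hB.unique hB₀]
  exact hRSle C hCx k n

/-- **CERTIFICATE for the forced tame branch**: `(C/‖k!‖_p)·p⁻ⁿ < ‖RS k n‖ ⟹ ‖[T^k]B‖ = ‖RS k n‖`
and `[T^k]B ≠ 0`, for every witness `B`. [cite: SteinWuthrich2013, §3] -/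
theorem IsTameBranchOf.norm_coeff_eq_forcedRiemannSum_of_lt (hχ : χ ≠ 1) (hã : ‖ã‖ = 1)
    (hU0 : ∀ s, ∑ d : ZMod p, ratPlusSymbol f (s + (d.val : ℚ) / p) = 0) {C₀ : ℝ}
    (hC₀ : ∀ s, ‖TwistPartner.forced χ (fun r ↦ ((ratPlusSymbol f r : ℚ) : ℚ_[p])) ã s‖ ≤ C₀)
    {B : PowerSeries ℚ_[p]} (hB : IsTameBranchOf f p (χ.ringHomComp (algebraMap ℚ_[p] ℂ_[p])) ã B)
    {C : ℝ} (hCx : ∀ r : ℚ, ‖((ratPlusSymbol f r : ℚ) : ℚ_[p])‖ ≤ C) {k n : ℕ}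
    (hlt : C / ‖((k.factorial : ℕ) : ℚ_[p])‖ * (p : ℝ) ^ (-n : ℤ) < ‖RS k n‖) :
    ‖PowerSeries.coeff k B‖ = ‖RS k n‖ ∧ PowerSeries.coeff k B ≠ 0 := by
  have herr : ‖PowerSeries.coeff k B - RS k n‖ < ‖RS k n‖ :=
    (hB.norm_coeff_sub_forcedRiemannSum_le hRS hχ hã hU0 hC₀ hCx k n).trans_lt hlt
  have heq : ‖PowerSeries.coeff k B‖ = ‖RS k n‖ := by
    have h := IsUltrametricDist.norm_add_eq_max_of_norm_ne_norm herr.ne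
    rw [sub_add_cancel, max_eq_right herr.le] at h
    exact h
  refine ⟨heq, fun h0 ↦ ?_⟩
  have hC0 : 0 ≤ C := (norm_nonneg _).trans (hCx 0)
  have hpos : 0 < ‖RS k n‖ :=
    lt_of_le_of_lt (mul_nonneg (div_nonneg hC0 (norm_nonneg _)) (zpow_nonneg (by positivity) _))
      hlt
  rw [h0, norm_zero] at heq
  exact hpos.ne heq

/-- **THE UNIT CERTIFICATE from ONE finite sum.** `χ ≠ 1`, `‖ã‖ = 1`, `U_p[·]⁺_f = 0`, the forced
partner bounded, the plus symbols `p`-INTEGRAL (`‖[r]⁺_f‖_p ≤ 1`), `k < p` and `n ≥ 1`: if the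
Riemann sum `RS k n = ∑_η ∑_{s mod pⁿ} μ(ηγˢ + p^{n+1}ℤ_p)·(s choose k)` is a `p`-adic UNIT, then
`‖[T^k]B‖ = 1` for every `B` with `IsTameBranchOf f p (ι∘χ) ã B` (`‖k!‖_p = 1`, `p⁻ⁿ < 1`). The
per-pair bit `hcert`/`hunit` of gen 20's rank-one consumers, as a finite statement about `f`'s own
`χ`-twisted symbols. [cite: SteinWuthrich2013, §3] [cite: MazurTateTeitelbaum1986Invent, §I.10 (10.1)] -/
theorem IsTameBranchOf.norm_coeff_eq_one_of_forcedRiemannSum (hχ : χ ≠ 1) (hã : ‖ã‖ = 1)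
    (hU0 : ∀ s, ∑ d : ZMod p, ratPlusSymbol f (s + (d.val : ℚ) / p) = 0) {C₀ : ℝ}
    (hC₀ : ∀ s, ‖TwistPartner.forced χ (fun r ↦ ((ratPlusSymbol f r : ℚ) : ℚ_[p])) ã s‖ ≤ C₀)
    {B : PowerSeries ℚ_[p]} (hB : IsTameBranchOf f p (χ.ringHomComp (algebraMap ℚ_[p] ℂ_[p])) ã B)
    (hint : ∀ r : ℚ, ‖((ratPlusSymbol f r : ℚ) : ℚ_[p])‖ ≤ 1) {k n : ℕ} (hk : k < p) (hn : 1 ≤ n)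
    (hunit : ‖RS k n‖ = 1) : ‖PowerSeries.coeff k B‖ = 1 := by
  have hp1 : (1 : ℝ) < p := by exact_mod_cast hp.out.one_lt
  have hfac : ‖((k.factorial : ℕ) : ℚ_[p])‖ = 1 := by
    have hnd : ¬ (p : ℤ) ∣ (k.factorial : ℤ) := by
      intro h
      have h' : p ∣ k.factorial := by exact_mod_cast h
      exact (Nat.not_le.mpr hk) (hp.out.dvd_factorial.mp h')
    rw [← Int.cast_natCast]
    exact le_antisymm (Padic.norm_int_le_one _)
      (not_lt.mp fun h ↦ hnd (Padic.norm_intCast_lt_one_iff.mp h))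
  have hlt : (1 : ℝ) / ‖((k.factorial : ℕ) : ℚ_[p])‖ * (p : ℝ) ^ (-n : ℤ) < ‖RS k n‖ := by
    rw [hfac, div_one, one_mul, hunit]
    calc (p : ℝ) ^ (-n : ℤ) < (p : ℝ) ^ (0 : ℤ) := zpow_lt_zpow_right₀ hp1 (by omega)
      _ = 1 := zpow_zero _
  rw [(hB.norm_coeff_eq_forcedRiemannSum_of_lt hRS hχ hã hU0 hC₀ hint hlt).1, hunit]

end Forced

end Summit.BirchSwinnertonDyer.Rank1Residual.Additive

end
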